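import Summits.BirchSwinnertonDyer.BirchSwinnertonDyer.Theorems.GenusKolyvaginAtTwoOffCutResidualAtTwoRSocleSelectionRealVisibleFrame
import Literature.NumberTheory.EllipticCurves.HeegnerPointsKolyvaginLocalCriterion
import Literature.NumberTheory.GaloisRepresentations.AbsGaloisRestrictRealPlace
import Literature.NumberTheory.EllipticCurves.GeomPointsGaloisModule
import HarnessLib

/-!
# Route `GenusKolyvaginAtTwo`, residual `OffCutResidualAtTwoR` (stmt-BirchSwinnertonDyer-31767), LINE 27 «socle_selection» STUB S2, conjunct (HL) —
# THE VISIBILITY CRITERION AT A REAL PLACE: a non-zero PHANTOM class of `H¹(K, E[2^k])` is NOT locally trivial at a real place `w` whose complex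
# conjugation `c_w ∈ Γ_K` splits `E[2^k]` as `ℤP ⊕ ℤQ` with `c_w P = P`, `c_w Q = −Q`

Seat `bsd-line-gk2-p4` g30 (cell `bsd-f1-sign2`), WIDTH-5 attach on route `GenusKolyvaginAtTwo` rev 59; sequel of `…SocleSelectionRealVisibleFrame`.
`--supports stmt-BirchSwinnertonDyer-31767 --as helper`.  THEOREMS ONLY (no definition, no named fact, no `sorry`); standard axioms.
**BSD is NOT proved by this file; `OffCutResidualAtTwoR` is NOT proved; LINE 27's stub S2 is NOT closed by this file alone.**

WHAT.  `K` a number field, `E = W/K` elliptic with `ρ̄_{E,2^k}` surjective (`k = j + 1 ≥ 1`), `w` a REAL place of `K` and `σ` an element of the local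
Galois group `Γ_{K_w}` (for the non-trivial one, `c_w := resGal K_w σ ∈ Γ_K` is a complex conjugation at `w`: tree `AbsGaloisRestrictRealPlace`,
`isComplexConjugationAt_absGaloisRestrict_of_ne_one`, `resGal_eq_absGaloisRestrict`).  The tree's strict local condition at `w` is
`W.torsionLocalKer K_w n = ker (H¹(K, E[n]) → H¹(K_w, E(K̄_w)[n]))` (`= resKer (resGal K_w) (torsionPointsMap …)`).
* §1 `apply_resGal_eq_smul_sub_of_mem_torsionLocalKer` — for ANY `K`-field `F` of characteristic `0` (a completion), a class in `torsionLocalKer F n`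
  (`n ≠ 0`) and ANY continuous crossed homomorphism `φ` representing it: **`φ(resGal F g) = resGal F g • P − P` for some `P ∈ E[n](K̄)` and all
  `g ∈ Γ_F`** (`E[n](K̄) → E(K̄_F)[n]` is an equivariant bijection, `torsionPointsMap_bijective`).
* §2 ★ `not_mem_torsionLocalKer_of_phantom_of_split` — if `c_w P = P`, `c_w Q = −Q`, `E[2^k] = ℤP + ℤQ` for `c_w = resGal K_w σ`, then every
  NON-ZERO `x ∈ H¹(K, E[2^k])` that is PHANTOM (`[x, ρ] = 0` for all `ρ ∈ Γ_{K(E[2^k])}`) is NOT in `torsionLocalKer K_w 2^k`; contrapositive ★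
  `eq_zero_of_phantom_of_mem_torsionLocalKer_of_split` — **a real-trivial phantom class is ZERO**.  Mechanism: `…RealVisibleFrame.apply_ne_smul_sub_of_split`
  (the Lawson–Wuthrich class is visible on `⟨c_w⟩`) against §1.
READING for LINE 27 (`Δ_E > 0`): the complex conjugation `c_∞` of `ℚ` fixes `E[2]` (all `2`-torsion real) and is an involution, so `E[2^k] = E[2^k]^+ + E[2^k]^−`
by halving in `E[2^(k+1)]`, of type `(1, 1)` for `k ≥ 2` (`E(ℝ)` has a point of order `4`, an egg `2`-torsion point is not halvable over `ℝ`) — the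
`(P, Q)` of §2; that archimedean computation is the remaining sequel.  BSD is NOT proved by any of this.

References: [LawsonWuthrich2016] Lemma 3, §7.1; [GrossLMS1991] §9 (pairing after Prop. 9.1), Prop. 8.2; [SerreGaloisCohomology1997] I.§5.8,
II.§6.1; [MilneADT2006] I §4 (p. 55).
-/

set_option autoImplicit false
set_option linter.dupNamespace false -- `Summit.<P>.<Sub>` repeats `BirchSwinnertonDyer` (D-0017)

noncomputable section

open scoped Classical

namespace Summit.BirchSwinnertonDyer.BirchSwinnertonDyer.Theorems.GenusExact.PlusDescent.SocleSelection.RealVisible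

open WeierstrassCurve Field NumberField Literature.NumberTheory.EllipticCurves Literature.NumberTheory.GaloisRepresentations

universe u

/-! ## §1 Classes in the strict local kernel are principal on the image of the local Galois group -/

section Local

variable {K : Type u} [Field K] [NumberField K] (W : WeierstrassCurve K) [W.IsElliptic]
variable (F : Type u) [Field F] [Algebra K F] [CharZero F]

/-- **A class in `torsionLocalKer F n` is principal on `resGal F (Γ_F)`, for EVERY representing cocycle.**  If the class of the continuous crossed
homomorphism `φ : Γ_K → E[n](K̄)` lies in `W.torsionLocalKer F n = ker (H¹(K, E[n]) → H¹(F, E(K̄_F)[n]))` (`n ≠ 0`), then there is `P ∈ E[n](K̄)` with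
`φ(resGal F g) = resGal F g • P − P` for all `g ∈ Γ_F`: the kernel condition gives such a `P` in `E(K̄_F)[n]`, and `E[n](K̄) → E(K̄_F)[n]` is an
equivariant bijection (`torsionPointsMap_bijective`, Silverman III.6.4 (b) over both closures). [cite: GrossLMS1991, Prop. 9.6] [cite: SilvermanAEC2009, Cor. III.6.4 (b)] -/
theorem apply_resGal_eq_smul_sub_of_mem_torsionLocalKer {n : ℕ} (hn : n ≠ 0)
    (φ : contOneCocycles (discreteTopRep (absoluteGaloisGroup K) (geomTorsion W (n : ℤ))))
    (hφ : oneCocycleClass _ φ ∈ W.torsionLocalKer F (n : ℤ)) :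
    ∃ P : geomTorsion W (n : ℤ), ∀ g : absoluteGaloisGroup F, φ.1 (resGal (K := K) F g) = resGal (K := K) F g • P - P := by
  rw [WeierstrassCurve.torsionLocalKer, oneCocycleClass_mem_resKer_iff] at hφ
  obtain ⟨a, ha⟩ := hφ
  obtain ⟨P, rfl⟩ := (torsionPointsMap_bijective W F hn).2 a
  refine ⟨P, fun g ↦ (torsionPointsMap_bijective W F hn).1 ?_⟩
  rw [ha g, map_sub, torsionPointsMap_smul]

end Local

/-! ## §2 ★ A non-zero phantom class is not locally trivial at a splitting complex conjugation -/

section Main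

variable {K : Type u} [Field K] [NumberField K] (W : WeierstrassCurve K) [W.IsElliptic]

/-- ★ **A NON-ZERO PHANTOM CLASS OF `H¹(K, E[2^k])` IS NOT IN THE STRICT LOCAL KERNEL AT `F`** when `c = resGal F σ` (some `σ ∈ Γ_F`; for `F = K_w`,
`w` real, `σ ≠ 1`: the complex conjugation at `w`) splits `E[2^k] = ℤP + ℤQ` with `cP = P`, `cQ = −Q` (`ρ̄_{E,2^k}` surjective, `k = j + 1`).
Proof: a phantom class lies in `ker (H¹ → H¹(Γ_{K(E[2^k])}))` and is the inflation of a crossed homomorphism `f` vanishing there; by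
`apply_ne_smul_sub_of_split`, `f(c) ∉ (c − 1)E[2^k]`; by §1 a class in `torsionLocalKer` has `f(c) ∈ (c − 1)E[2^k]`.
[cite: LawsonWuthrich2016, Lemma 3, §7.1] [cite: GrossLMS1991, §9] [cite: SerreGaloisCohomology1997, I.§5.8] -/
theorem not_mem_torsionLocalKer_of_phantom_of_split (j : ℕ)
    (hsurj : W.HasSurjectiveModNGaloisRep ((2 ^ (j + 1) : ℕ) : ℤ))
    (F : Type u) [Field F] [Algebra K F] [CharZero F] (σ : absoluteGaloisGroup F)
    {P Q : geomTorsion W ((2 ^ (j + 1) : ℕ) : ℤ)}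
    (hP : resGal (K := K) F σ • P = P) (hQ : resGal (K := K) F σ • Q = -Q)
    (hPQ : ∀ R : geomTorsion W ((2 ^ (j + 1) : ℕ) : ℤ), ∃ a b : ℤ, R = a • P + b • Q)
    {x : galH1Torsion W ((2 ^ (j + 1) : ℕ) : ℤ)}
    (hph : ∀ ρ ∈ torsionFixing W ((2 ^ (j + 1) : ℕ) : ℤ), h1Eval W _ x ρ = 0) (hx0 : x ≠ 0) :
    x ∉ W.torsionLocalKer F ((2 ^ (j + 1) : ℕ) : ℤ) := by
  have h2 : (2 : K) ≠ 0 := two_ne_zero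
  have hn0 : (((2 ^ (j + 1) : ℕ) : ℤ)) ≠ 0 := by exact_mod_cast pow_ne_zero _ two_ne_zero
  have hN₀ : IsOpen (torsionFixing W ((2 ^ (j + 1) : ℕ) : ℤ) : Set (absoluteGaloisGroup K)) := isOpen_torsionFixing W hn0
  -- phantom ⟹ in the kernel of restriction to `Γ_{K(E[2^k])}` ⟹ inflated
  have hmem : x ∈ subgroupResKer (geomTorsion W ((2 ^ (j + 1) : ℕ) : ℤ)) (torsionFixing W ((2 ^ (j + 1) : ℕ) : ℤ)) := by
    have h := (oneCocycleClass_mem_subgroupResKer_iff _ (reprCocycle W _ x)).2 ⟨0, fun ρ ↦ by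
      rw [smul_zero, sub_zero]
      exact hph ρ ρ.2⟩
    rwa [oneCocycleClass_reprCocycle] at h
  have hrange := resKer_le_range_inflClass (subgroupIncl (torsionFixing W ((2 ^ (j + 1) : ℕ) : ℤ)))
    (AddMonoidHom.id (geomTorsion W ((2 ^ (j + 1) : ℕ) : ℤ))) (fun _ _ ↦ rfl) Function.bijective_id
    (torsionFixing W ((2 ^ (j + 1) : ℕ) : ℤ)) hN₀ (fun n hn ↦ ⟨⟨n, hn⟩, rfl⟩)
  obtain ⟨f, hfx⟩ := hrange hmem
  have hf0 : inflClass (geomTorsion W ((2 ^ (j + 1) : ℕ) : ℤ)) (torsionFixing W ((2 ^ (j + 1) : ℕ) : ℤ)) hN₀ f ≠ 0 := by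
    rw [hfx]; exact hx0
  -- in the strict local kernel ⟹ principal on `c = resGal F σ`
  intro hloc
  rw [← hfx, inflClass_apply] at hloc
  obtain ⟨P₀, hP₀⟩ := apply_resGal_eq_smul_sub_of_mem_torsionLocalKer W F (pow_ne_zero (j + 1) two_ne_zero) _ hloc
  have hc := hP₀ σ
  rw [toContOneCocycle_apply] at hc
  exact apply_ne_smul_sub_of_split W j h2 hsurj hP hQ hPQ f hf0 P₀ hc

/-- ★ **A REAL-TRIVIAL PHANTOM CLASS IS ZERO** (contrapositive packaging, the shape used by LINE 27's (HL)): `x ∈ H¹(K, E[2^k])` with `[x, ρ] = 0` for all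
`ρ ∈ Γ_{K(E[2^k])}` and `x ∈ torsionLocalKer F 2^k`, where `c = resGal F σ` splits `E[2^k] = ℤP + ℤQ`, `cP = P`, `cQ = −Q` — then `x = 0`.
[cite: LawsonWuthrich2016, Lemma 3, §7.1] [cite: GrossLMS1991, §9] -/
theorem eq_zero_of_phantom_of_mem_torsionLocalKer_of_split (j : ℕ)
    (hsurj : W.HasSurjectiveModNGaloisRep ((2 ^ (j + 1) : ℕ) : ℤ))
    (F : Type u) [Field F] [Algebra K F] [CharZero F] (σ : absoluteGaloisGroup F)
    {P Q : geomTorsion W ((2 ^ (j + 1) : ℕ) : ℤ)}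
    (hP : resGal (K := K) F σ • P = P) (hQ : resGal (K := K) F σ • Q = -Q)
    (hPQ : ∀ R : geomTorsion W ((2 ^ (j + 1) : ℕ) : ℤ), ∃ a b : ℤ, R = a • P + b • Q)
    {x : galH1Torsion W ((2 ^ (j + 1) : ℕ) : ℤ)}
    (hph : ∀ ρ ∈ torsionFixing W ((2 ^ (j + 1) : ℕ) : ℤ), h1Eval W _ x ρ = 0)
    (hloc : x ∈ W.torsionLocalKer F ((2 ^ (j + 1) : ℕ) : ℤ)) : x = 0 := by
  by_contra hx0
  exact not_mem_torsionLocalKer_of_phantom_of_split W j hsurj F σ hP hQ hPQ hph hx0 hloc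

/-- ★ **At a REAL place `w`: the complex conjugation form.**  `σ ≠ 1` in `Γ_{K_w}` (it exists: `exists_ne_one_forall_eq_of_isReal`); `c_w := resGal K_w σ` is then
a complex conjugation at `w` (`isComplexConjugationAt_absGaloisRestrict_of_ne_one`) and an involution.  If `c_w` splits `E[2^k]` as `ℤP + ℤQ` with
`c_w P = P`, `c_w Q = −Q`, every phantom class in the strict local kernel at `w` vanishes.  [cite: LawsonWuthrich2016, §7.1] [cite: SerreGaloisCohomology1997, II.§6.1] -/
theorem eq_zero_of_phantom_of_mem_torsionLocalKer_infinitePlace_of_split (j : ℕ)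
    (hsurj : W.HasSurjectiveModNGaloisRep ((2 ^ (j + 1) : ℕ) : ℤ))
    (w : InfinitePlace K) (σ : absoluteGaloisGroup w.Completion)
    {P Q : geomTorsion W ((2 ^ (j + 1) : ℕ) : ℤ)}
    (hP : resGal (K := K) w.Completion σ • P = P) (hQ : resGal (K := K) w.Completion σ • Q = -Q)
    (hPQ : ∀ R : geomTorsion W ((2 ^ (j + 1) : ℕ) : ℤ), ∃ a b : ℤ, R = a • P + b • Q)
    {x : galH1Torsion W ((2 ^ (j + 1) : ℕ) : ℤ)}
    (hph : ∀ ρ ∈ torsionFixing W ((2 ^ (j + 1) : ℕ) : ℤ), h1Eval W _ x ρ = 0)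
    (hloc : x ∈ W.torsionLocalKer w.Completion ((2 ^ (j + 1) : ℕ) : ℤ)) : x = 0 := by
  haveI : CharZero w.Completion := charZero_of_injective_algebraMap (algebraMap K w.Completion).injective
  exact eq_zero_of_phantom_of_mem_torsionLocalKer_of_split W j hsurj w.Completion σ hP hQ hPQ hph hloc

end Main

end Summit.BirchSwinnertonDyer.BirchSwinnertonDyer.Theorems.GenusExact.PlusDescent.SocleSelection.RealVisible

end
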